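import Literature.NumberTheory.Sieve.PairLinearFormDivisorSums
import HarnessLib

/-!
# Divisor powers of `n` and `n + h` over rough `n`, all `n` (Matomäki–Merikoski Lemma 3.1(i), coarse form)

Topic `Literature/NumberTheory/Sieve`.  Everything in this file is PROVED.  For `1 ≤ h ≤ x^B`, sieving
levels `2 ≤ w₁, w₂ ≤ x` and exponents `a, b`:

  `∑_{n ≤ x, n w₁-rough, (n+h, P_h(w₂)) = 1} τ(n)^a τ(n+h)^b`
  `≤ C (h/φ(h)) · x/(log w₁ log w₂) · (log x/log w₁)^κ (log x/log w₂)^κ`,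

`C = C(a,b,B)`, `κ = κ(a,b,B)` (`PairDivisorSums.sum_pow_card_divisors_shift_le`); here
"`(n+h, P_h(w₂)) = 1`" is the source's condition "every prime factor `p < w₂` of `n + h` divides `h`".
This is Lemma 3.1(i) of Matomäki–Merikoski (IMRN 2023; arXiv:2112.11412, p. 9 of the arXiv version) for
the sign `+`, in a COARSE form: the exponents `κ` are not the sharp `2^{a}+1, 2^{b}` of the source (which
rests on Henriot's Nair–Tenenbaum bound), and `h ≤ X^{10}` is replaced by `h ≤ x^B` (constants depending on
`B`).  The coarse exponents suffice wherever the source only needs polynomial dependence on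
`log X/log wᵢ` — (2.6) of the arXiv version ("ConsHenriot"), the first step of §5, the part `(n,h) > 1`
of Lemma 2.1 — NOT for the main part of Lemma 2.1.

## Proof

* The `n` coprime to `h` are the case `m = 1` of the tree's
  `PairDivisorSums.sum_pow_card_divisors_le` (`n + h` is then coprime to `h`, so the condition
  "`P_h(w₂)`-rough" is plain `w₂`-roughness).
* The `n` with `(n, h) > 1` (the source's treatment in the proof of its Lemma 2.1, p. 9–10): such an `n`
  is `p n'` with `p ∣ h`, `p ≥ w₁` prime; `τ(pk) ≤ 2τ(k)`, `n + h = p(n' + h/p)`, and the crude bound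
  `∑_{n ≤ y} τ(n)^a τ(n+h')^b ≪ (y + x^{1/2}) (log x)^c` (`crude_shifted_sum_le`: `uv ≤ u² + v²`, the
  plain divisor power sum, and Landreau's inequality with cutoff `x^{1/2}` for the shifted factor) give
  `≪ ω(h) (x/w₁ + x^{1/2}) (log x)^{c}`, which is absorbed by enlarging `κ`
  (`(log w₁)^{κ+1} ≪ w₁`, `ω(h) ≤ B log x/log 2`).

## References

* K. Matomäki, J. Merikoski, IMRN 2023:23, 20337–20384 (arXiv:2112.11412), Lemma 3.1(i) and the proof
  of Lemma 2.1 (p. 9–10). [cite: MatomakiMerikoski2023, Lemma 3.1]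
* K. Henriot, Math. Proc. Cambridge Philos. Soc. 152 (2012) 405–424, Thm 3 (arXiv:1102.1643). [Henriot2012]
-/

noncomputable section

open Finset Real
open scoped ArithmeticFunction.sigma

namespace Literature.NumberTheory.Sieve

namespace PairDivisorSums

/-! ### Small tools -/

/-- `τ(ab) ≤ τ(a)τ(b)`. [folklore] -/
private theorem card_divisors_mul_le' (a b : ℕ) :
    (a * b).divisors.card ≤ a.divisors.card * b.divisors.card := by
  rw [Nat.divisors_mul]; exact Finset.card_mul_le

/-- `τ(pk) ≤ 2τ(k)` for a prime `p`. [folklore] -/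
theorem card_divisors_prime_mul_le {p : ℕ} (hp : p.Prime) (k : ℕ) :
    (p * k).divisors.card ≤ 2 * k.divisors.card := by
  refine (card_divisors_mul_le' p k).trans ?_
  rw [hp.divisors, Finset.card_pair hp.one_lt.ne]

/-- `(log x)^c ≤ K_c √x` for `x ≥ 1`. [folklore] -/
private theorem log_pow_le_mul_sqrt' (c : ℕ) :
    ∃ K : ℝ, 0 < K ∧ ∀ x : ℝ, 1 ≤ x → Real.log x ^ c ≤ K * Real.sqrt x := by
  rcases Nat.eq_zero_or_pos c with rfl | hc
  · refine ⟨1, one_pos, fun x hx => ?_⟩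
    rw [pow_zero, one_mul]
    exact Real.one_le_sqrt.mpr hx
  refine ⟨(2 * (c : ℝ)) ^ c, by positivity, fun x hx => ?_⟩
  have hs : (0 : ℝ) < 1 / (2 * c) := by positivity
  have h1 : Real.log x ≤ x ^ (1 / (2 * (c : ℝ))) / (1 / (2 * c)) := Real.log_le_rpow_div (by linarith) hs
  have h2 : Real.log x ≤ (2 * c) * x ^ (1 / (2 * (c : ℝ))) := by
    rw [div_div_eq_mul_div, div_one] at h1
    linarith
  have h0 : 0 ≤ Real.log x := Real.log_nonneg hx
  calc Real.log x ^ c ≤ ((2 * c) * x ^ (1 / (2 * (c : ℝ)))) ^ c := pow_le_pow_left₀ h0 h2 c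
    _ = (2 * (c : ℝ)) ^ c * (x ^ (1 / (2 * (c : ℝ)))) ^ (c : ℕ) := by ring
    _ = (2 * (c : ℝ)) ^ c * Real.sqrt x := by
        rw [← Real.rpow_natCast (x ^ (1 / (2 * (c : ℝ)))) c, ← Real.rpow_mul (by linarith),
          Real.sqrt_eq_rpow]
        congr 2
        field_simp

/-- The number of `n ∈ [1, y]` with `e ∣ n + h` is at most `y/e + 1`. [folklore] -/
theorem card_filter_dvd_add_le (e h y : ℕ) (he : 0 < e) :
    (#{n ∈ Icc 1 y | e ∣ n + h} : ℝ) ≤ (y : ℝ) / e + 1 := by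
  have hinj : #{n ∈ Icc 1 y | e ∣ n + h} ≤ #(Icc (h / e + 1) ((h + y) / e)) := by
    refine Finset.card_le_card_of_injOn (fun n => (n + h) / e) ?_ ?_
    · intro n hn
      rw [Finset.mem_coe, Finset.mem_filter, Finset.mem_Icc] at hn
      obtain ⟨⟨hn1, hny⟩, k, hk⟩ := hn
      simp only [Finset.mem_coe, Finset.mem_Icc]
      rw [hk, Nat.mul_div_cancel_left k he]
      constructor
      · rw [Nat.succ_le_iff, Nat.div_lt_iff_lt_mul he]
        calc h < n + h := by omega
          _ = k * e := by rw [hk, mul_comm]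
      · rw [Nat.le_div_iff_mul_le he]
        calc k * e = n + h := by rw [hk, mul_comm]
          _ ≤ h + y := by omega
    · intro n₁ hn₁ n₂ hn₂ heq
      rw [Finset.mem_coe, Finset.mem_filter] at hn₁ hn₂
      have h1 := Nat.div_mul_cancel hn₁.2
      have h2 := Nat.div_mul_cancel hn₂.2
      have heq' : (n₁ + h) / e = (n₂ + h) / e := heq
      have : n₁ + h = n₂ + h := by rw [← h1, ← h2, heq']
      omega
  rw [Nat.card_Icc] at hinj
  have hcast : (#{n ∈ Icc 1 y | e ∣ n + h} : ℝ) ≤ (((h + y) / e + 1 - (h / e + 1) : ℕ) : ℝ) := by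
    exact_mod_cast hinj
  refine hcast.trans ?_
  have hle : h / e + 1 ≤ (h + y) / e + 1 := Nat.add_le_add_right (Nat.div_le_div_right (by omega)) 1
  rw [Nat.cast_sub hle]
  push_cast
  have he' : (0 : ℝ) < e := by exact_mod_cast he
  have hup : (((h + y) / e : ℕ) : ℝ) ≤ ((h : ℝ) + y) / e := by
    have := (Nat.cast_div_le : (((h + y) / e : ℕ) : ℝ) ≤ ((h + y : ℕ) : ℝ) / e)
    push_cast at this
    exact this
  have hdown : (h : ℝ) / e - 1 ≤ ((h / e : ℕ) : ℝ) := by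
    have h1 := Nat.lt_div_mul_add he (a := h)
    have h1' : (h : ℝ) < ((h / e : ℕ) : ℝ) * e + e := by exact_mod_cast h1
    rw [sub_le_iff_le_add, div_le_iff₀ he']
    linarith
  rw [add_div] at hup
  linarith

/-- Multiples of `p` in `[1, x]`: `∑_{n ≤ x, p ∣ n} f(n) = ∑_{k ≤ x/p} f(pk)`. [folklore] -/
theorem sum_filter_dvd_eq {p : ℕ} (hp : 0 < p) (x : ℕ) (f : ℕ → ℝ) :
    ∑ n ∈ (Icc 1 x).filter (fun n => p ∣ n), f n = ∑ k ∈ Icc 1 (x / p), f (p * k) := by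
  have hset : (Icc 1 x).filter (fun n => p ∣ n) =
      (Icc 1 (x / p)).map ⟨fun k => p * k, mul_right_injective₀ hp.ne'⟩ := by
    ext n
    simp only [Finset.mem_filter, Finset.mem_Icc, Finset.mem_map, Function.Embedding.coeFn_mk]
    constructor
    · rintro ⟨⟨hn1, hnx⟩, k, hk⟩
      refine ⟨k, ⟨?_, ?_⟩, hk.symm⟩
      · rcases Nat.eq_zero_or_pos k with rfl | hk0
        · omega
        · exact hk0
      · rw [Nat.le_div_iff_mul_le hp, mul_comm, ← hk]; exact hnx
    · rintro ⟨k, ⟨hk1, hkx⟩, rfl⟩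
      refine ⟨⟨?_, ?_⟩, dvd_mul_right p k⟩
      · exact Nat.le_trans hp (Nat.le_mul_of_pos_right p hk1)
      · rw [Nat.le_div_iff_mul_le hp] at hkx
        rw [mul_comm]; exact hkx
  rw [hset, Finset.sum_map]
  rfl

/-! ### The crude bound for shifted divisor power sums -/

set_option maxHeartbeats 800000 in
/-- Crude bound: for `x ≥ 8`, `1 ≤ h' ≤ x^B` and `y ≤ x`,
`∑_{n ≤ y} τ(n)^a τ(n + h')^b ≤ C (y + √x) (log x)^c` (`uv ≤ u² + v²`, the plain divisor power sum for
`τ(n)^{2a}`, and Landreau's inequality with cutoff `x^{1/2}` for `τ(n+h')^{2b}`: the multiples of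
`e ≤ x^{1/2}` among the `n + h'` number `≤ y/e + 1`). [folklore] -/
theorem crude_shifted_sum_le (a b B : ℕ) : ∃ C : ℝ, 0 < C ∧ ∃ c : ℕ, ∀ (x h y : ℕ), 8 ≤ x → 1 ≤ h →
    (h : ℝ) ≤ (x : ℝ) ^ B → y ≤ x →
      ∑ n ∈ Icc 1 y, ((n.divisors.card : ℝ)) ^ a * (((n + h).divisors.card : ℝ)) ^ b ≤
        C * ((y : ℝ) + Real.sqrt x) * Real.log x ^ c := by
  obtain ⟨C₅, hC₅, hP⟩ := exists_sum_sigma_zero_pow_le (2 * a)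
  obtain ⟨C₂, hC₂, M, hL⟩ := card_divisors_pow_le_sum_Icc
    (show (0 : ℝ) < 1 / (2 * ((B : ℝ) + 2)) by positivity) (2 * b)
  obtain ⟨C₃, hC₃, hD⟩ := exists_sum_sigma_zero_pow_div_le_real M
  obtain ⟨C₄, hC₄, hE⟩ := exists_sum_sigma_zero_pow_le_real M
  obtain ⟨c, hc⟩ : ∃ c : ℕ, c = 2 ^ (2 * a + 1) + 2 ^ (M + 1) := ⟨_, rfl⟩
  refine ⟨C₅ + 1 + C₂ * C₃ + C₂ * C₄, by positivity, c, ?_⟩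
  intro x h y hx hh hhB hyx
  have hx0 : (0 : ℝ) < x := by exact_mod_cast (show 0 < x by omega)
  have hx1 : (1 : ℝ) ≤ x := by exact_mod_cast (show 1 ≤ x by omega)
  have hx8 : (8 : ℝ) ≤ x := by exact_mod_cast hx
  have hlogx1 : 1 ≤ Real.log x := by
    rw [Real.le_log_iff_exp_le hx0]
    have := Real.exp_one_lt_d9
    linarith
  have hlogx0 : 0 ≤ Real.log x := by linarith
  have hy' : (y : ℝ) ≤ x := by exact_mod_cast hyx
  -- `s = x^{1/2} = √x ≥ 2`
  obtain ⟨s, hs⟩ : ∃ s : ℝ, s = Real.sqrt x := ⟨_, rfl⟩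
  have hs2 : 2 ≤ s := by
    have h4 : Real.sqrt 4 = 2 := by
      rw [show (4 : ℝ) = 2 ^ 2 by norm_num, Real.sqrt_sq (by norm_num)]
    rw [hs, ← h4]
    exact Real.sqrt_le_sqrt (by linarith)
  have hs1 : 1 ≤ s := by linarith
  have hs0 : 0 < s := by linarith
  have hlogs : Real.log s = Real.log x / 2 := by
    rw [hs, Real.sqrt_eq_rpow, Real.log_rpow hx0]; ring
  have hlogs0 : 0 ≤ Real.log s := by rw [hlogs]; linarith
  have hlogsx : Real.log s ≤ Real.log x := by rw [hlogs]; linarith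
  have hXε : ((x : ℝ) ^ ((B : ℝ) + 2)) ^ (1 / (2 * ((B : ℝ) + 2))) = s := by
    rw [hs, Real.sqrt_eq_rpow, ← Real.rpow_mul hx0.le]
    congr 1
    field_simp
  have hXeq : (x : ℝ) ^ ((B : ℝ) + 2) = (x : ℝ) ^ (B + 2) := by
    rw [show ((B : ℝ) + 2) = ((B + 2 : ℕ) : ℝ) by push_cast; ring, Real.rpow_natCast]
  -- powers of `log x` compared with `(log x)^c`
  have hlogpow : ∀ e : ℕ, e ≤ c → Real.log x ^ e ≤ Real.log x ^ c := fun e he =>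
    pow_le_pow_right₀ hlogx1 he
  -- size of `n + h`
  have hN : ∀ n : ℕ, n ≤ y → ((n + h : ℕ) : ℝ) ≤ (x : ℝ) ^ (B + 2) := by
    intro n hn
    have hn' : (n : ℝ) ≤ x := le_trans (by exact_mod_cast hn) hy'
    have h1 : (x : ℝ) ≤ (x : ℝ) ^ (B + 1) := by
      calc (x : ℝ) = (x : ℝ) ^ 1 := (pow_one _).symm
        _ ≤ (x : ℝ) ^ (B + 1) := pow_le_pow_right₀ hx1 (by omega)
    have h2 : (x : ℝ) ^ B ≤ (x : ℝ) ^ (B + 1) := pow_le_pow_right₀ hx1 (by omega)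
    have h3 : (x : ℝ) ^ (B + 2) = (x : ℝ) ^ (B + 1) * x := by ring
    push_cast
    nlinarith [pow_nonneg hx0.le (B + 1)]
  -- (1) pointwise `uv ≤ u² + v²`
  have hpt : ∀ n : ℕ, ((n.divisors.card : ℝ)) ^ a * (((n + h).divisors.card : ℝ)) ^ b ≤
      ((n.divisors.card : ℝ)) ^ (2 * a) + (((n + h).divisors.card : ℝ)) ^ (2 * b) := by
    intro n
    have hu : 0 ≤ ((n.divisors.card : ℝ)) ^ a := by positivity
    have hv : 0 ≤ (((n + h).divisors.card : ℝ)) ^ b := by positivity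
    rw [pow_mul', pow_mul']
    nlinarith [sq_nonneg (((n.divisors.card : ℝ)) ^ a - (((n + h).divisors.card : ℝ)) ^ b), mul_nonneg hu hv]
  -- (2) the plain divisor power sum
  have hplain : ∑ n ∈ Icc 1 y, ((n.divisors.card : ℝ)) ^ (2 * a) ≤ (C₅ + 1) * ((y : ℝ) + s) * Real.log x ^ c := by
    have hterm0 : ∀ n ∈ Icc 1 y, 0 ≤ ((n.divisors.card : ℝ)) ^ (2 * a) := fun _ _ => by positivity
    have hbig : 0 ≤ (C₅ + 1) * ((y : ℝ) + s) * Real.log x ^ c := by positivity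
    rcases Nat.lt_or_ge y 2 with hy2 | hy2
    · -- `y ≤ 1`: the sum is at most `1`
      have hle1 : ∑ n ∈ Icc 1 y, ((n.divisors.card : ℝ)) ^ (2 * a) ≤ 1 := by
        interval_cases y
        · simp
        · simp
      calc _ ≤ (1 : ℝ) := hle1
        _ ≤ (C₅ + 1) * ((y : ℝ) + s) * Real.log x ^ c := by
            have h1 : (1 : ℝ) ≤ (C₅ + 1) := by linarith
            have h2 : (1 : ℝ) ≤ (y : ℝ) + s := by linarith [(Nat.cast_nonneg y : (0 : ℝ) ≤ y)]
            have h3 : (1 : ℝ) ≤ Real.log x ^ c := one_le_pow₀ hlogx1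
            calc (1 : ℝ) = 1 * 1 * 1 := by ring
              _ ≤ (C₅ + 1) * ((y : ℝ) + s) * Real.log x ^ c :=
                  mul_le_mul (mul_le_mul h1 h2 zero_le_one (by positivity)) h3 zero_le_one (by positivity)
    · have h1 := hP y hy2
      have hy2' : (2 : ℝ) ≤ y := by exact_mod_cast hy2
      have hlogy : Real.log y ≤ Real.log x := Real.log_le_log (by linarith) hy'
      have hlogy0 : 0 ≤ Real.log y := Real.log_nonneg (by linarith)
      calc ∑ n ∈ Icc 1 y, ((n.divisors.card : ℝ)) ^ (2 * a) = ∑ n ∈ Icc 1 y, (σ 0 n : ℝ) ^ (2 * a) := by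
            refine Finset.sum_congr rfl fun n _ => ?_
            rw [ArithmeticFunction.sigma_zero_apply]
        _ ≤ C₅ * y * Real.log y ^ 2 ^ (2 * a + 1) := h1
        _ ≤ C₅ * y * Real.log x ^ c := by
            refine mul_le_mul_of_nonneg_left ?_ (by positivity)
            exact (pow_le_pow_left₀ hlogy0 hlogy _).trans (hlogpow _ (by rw [hc]; exact Nat.le_add_right _ _))
        _ ≤ (C₅ + 1) * ((y : ℝ) + s) * Real.log x ^ c := by
            refine mul_le_mul_of_nonneg_right ?_ (by positivity)
            nlinarith [(Nat.cast_nonneg y : (0 : ℝ) ≤ y)]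
  -- (3) the shifted divisor power sum via Landreau
  have hshift : ∑ n ∈ Icc 1 y, (((n + h).divisors.card : ℝ)) ^ (2 * b) ≤
      (C₂ * C₃ + C₂ * C₄) * ((y : ℝ) + s) * Real.log x ^ c := by
    -- Landreau for each term
    have hL' : ∀ n ∈ Icc 1 y, (((n + h).divisors.card : ℝ)) ^ (2 * b) ≤
        C₂ * ∑ e ∈ Icc 1 ⌊s⌋₊, if e ∣ n + h then ((e.divisors.card : ℕ) : ℝ) ^ M else 0 := by
      intro n hn
      rw [Finset.mem_Icc] at hn
      have h1 := hL ((x : ℝ) ^ ((B : ℝ) + 2)) (n + h) (by omega) (by rw [hXeq]; exact hN n hn.2)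
      rw [hXε] at h1
      exact h1
    have hswap : ∑ n ∈ Icc 1 y, (C₂ * ∑ e ∈ Icc 1 ⌊s⌋₊, if e ∣ n + h then ((e.divisors.card : ℕ) : ℝ) ^ M else 0) =
        C₂ * ∑ e ∈ Icc 1 ⌊s⌋₊, ((e.divisors.card : ℕ) : ℝ) ^ M * #{n ∈ Icc 1 y | e ∣ n + h} := by
      rw [← Finset.mul_sum, Finset.sum_comm]
      congr 1
      refine Finset.sum_congr rfl fun e _ => ?_
      rw [← Finset.sum_filter, Finset.sum_const, nsmul_eq_mul, mul_comm]
    have hcount : ∀ e ∈ Icc 1 ⌊s⌋₊, ((e.divisors.card : ℕ) : ℝ) ^ M * (#{n ∈ Icc 1 y | e ∣ n + h} : ℝ) ≤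
        (y : ℝ) * (((e.divisors.card : ℕ) : ℝ) ^ M / e) + ((e.divisors.card : ℕ) : ℝ) ^ M := by
      intro e he
      rw [Finset.mem_Icc] at he
      have he0 : (0 : ℝ) < e := by exact_mod_cast he.1
      have h1 := card_filter_dvd_add_le e h y he.1
      have h0 : 0 ≤ ((e.divisors.card : ℕ) : ℝ) ^ M := by positivity
      calc _ ≤ ((e.divisors.card : ℕ) : ℝ) ^ M * ((y : ℝ) / e + 1) := mul_le_mul_of_nonneg_left h1 h0
        _ = _ := by field_simp
    have hD' : ∑ e ∈ Icc 1 ⌊s⌋₊, ((e.divisors.card : ℕ) : ℝ) ^ M / e ≤ C₃ * Real.log x ^ c := by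
      have h1 := hD s hs2
      calc ∑ e ∈ Icc 1 ⌊s⌋₊, ((e.divisors.card : ℕ) : ℝ) ^ M / e = ∑ n ∈ Icc 1 ⌊s⌋₊, (σ 0 n : ℝ) ^ M / n := by
            refine Finset.sum_congr rfl fun n _ => ?_
            rw [ArithmeticFunction.sigma_zero_apply]
        _ ≤ C₃ * Real.log s ^ 2 ^ (M + 1) := h1
        _ ≤ C₃ * Real.log x ^ c := by
            refine mul_le_mul_of_nonneg_left ?_ hC₃.le
            exact (pow_le_pow_left₀ hlogs0 hlogsx _).trans (hlogpow _ (by rw [hc]; exact Nat.le_add_left _ _))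
    have hE' : ∑ e ∈ Icc 1 ⌊s⌋₊, ((e.divisors.card : ℕ) : ℝ) ^ M ≤ C₄ * s * Real.log x ^ c := by
      have h1 := hE s hs2
      calc ∑ e ∈ Icc 1 ⌊s⌋₊, ((e.divisors.card : ℕ) : ℝ) ^ M = ∑ n ∈ Icc 1 ⌊s⌋₊, (σ 0 n : ℝ) ^ M := by
            refine Finset.sum_congr rfl fun n _ => ?_
            rw [ArithmeticFunction.sigma_zero_apply]
        _ ≤ C₄ * s * Real.log s ^ 2 ^ (M + 1) := h1
        _ ≤ C₄ * s * Real.log x ^ c := by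
            refine mul_le_mul_of_nonneg_left ?_ (by positivity)
            exact (pow_le_pow_left₀ hlogs0 hlogsx _).trans (hlogpow _ (by rw [hc]; exact Nat.le_add_left _ _))
    calc ∑ n ∈ Icc 1 y, (((n + h).divisors.card : ℝ)) ^ (2 * b)
        ≤ ∑ n ∈ Icc 1 y, (C₂ * ∑ e ∈ Icc 1 ⌊s⌋₊, if e ∣ n + h then ((e.divisors.card : ℕ) : ℝ) ^ M else 0) :=
          Finset.sum_le_sum hL'
      _ = C₂ * ∑ e ∈ Icc 1 ⌊s⌋₊, ((e.divisors.card : ℕ) : ℝ) ^ M * #{n ∈ Icc 1 y | e ∣ n + h} := hswap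
      _ ≤ C₂ * ∑ e ∈ Icc 1 ⌊s⌋₊, ((y : ℝ) * (((e.divisors.card : ℕ) : ℝ) ^ M / e) + ((e.divisors.card : ℕ) : ℝ) ^ M) :=
          mul_le_mul_of_nonneg_left (Finset.sum_le_sum hcount) hC₂.le
      _ = C₂ * ((y : ℝ) * ∑ e ∈ Icc 1 ⌊s⌋₊, ((e.divisors.card : ℕ) : ℝ) ^ M / e +
            ∑ e ∈ Icc 1 ⌊s⌋₊, ((e.divisors.card : ℕ) : ℝ) ^ M) := by
          rw [Finset.sum_add_distrib, Finset.mul_sum]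
      _ ≤ C₂ * ((y : ℝ) * (C₃ * Real.log x ^ c) + C₄ * s * Real.log x ^ c) := by
          refine mul_le_mul_of_nonneg_left (add_le_add ?_ hE') hC₂.le
          exact mul_le_mul_of_nonneg_left hD' (Nat.cast_nonneg y)
      _ ≤ (C₂ * C₃ + C₂ * C₄) * ((y : ℝ) + s) * Real.log x ^ c := by
          have hy0 : (0 : ℝ) ≤ y := Nat.cast_nonneg y
          have hl0 : 0 ≤ Real.log x ^ c := by positivity
          nlinarith [mul_nonneg (mul_nonneg hC₂.le hC₃.le) (mul_nonneg hs0.le hl0),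
            mul_nonneg (mul_nonneg hC₂.le hC₄.le) (mul_nonneg hy0 hl0)]
  -- assemble
  rw [← hs]
  calc ∑ n ∈ Icc 1 y, ((n.divisors.card : ℝ)) ^ a * (((n + h).divisors.card : ℝ)) ^ b
      ≤ ∑ n ∈ Icc 1 y, (((n.divisors.card : ℝ)) ^ (2 * a) + (((n + h).divisors.card : ℝ)) ^ (2 * b)) :=
        Finset.sum_le_sum fun n _ => hpt n
    _ = ∑ n ∈ Icc 1 y, ((n.divisors.card : ℝ)) ^ (2 * a) + ∑ n ∈ Icc 1 y, (((n + h).divisors.card : ℝ)) ^ (2 * b) :=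
        Finset.sum_add_distrib
    _ ≤ (C₅ + 1) * ((y : ℝ) + s) * Real.log x ^ c + (C₂ * C₃ + C₂ * C₄) * ((y : ℝ) + s) * Real.log x ^ c :=
        add_le_add hplain hshift
    _ = (C₅ + 1 + C₂ * C₃ + C₂ * C₄) * ((y : ℝ) + s) * Real.log x ^ c := by ring

/-! ### The theorem -/

set_option maxHeartbeats 800000 in
/-- **Matomäki–Merikoski Lemma 3.1(i), coarse form** (sign `+`, all `n`).  For all `a, b, B` there are
`C > 0` and `κ` such that for all naturals `x ≥ 2`, `1 ≤ h ≤ x^B` and all `2 ≤ w₁, w₂ ≤ x`: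
`∑_{n ≤ x, n w₁-rough, (n+h, P_h(w₂)) = 1} τ(n)^a τ(n+h)^b ≤ C (h/φ(h)) x/(log w₁ log w₂) (log x/log w₁)^κ (log x/log w₂)^κ`,
where "`(n + h, P_h(w₂)) = 1`" means that every prime factor `p < w₂` of `n + h` divides `h` (the
source, p. 9 of the arXiv version, has the sharp exponents `2^a + 1, 2^b` and the range `h ≤ X^{10}`).
[cite: MatomakiMerikoski2023, Lemma 3.1(i)] -/
theorem sum_pow_card_divisors_shift_le (a b B : ℕ) : ∃ C : ℝ, 0 < C ∧ ∃ κ : ℕ, ∀ (x h : ℕ), 2 ≤ x →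
    1 ≤ h → (h : ℝ) ≤ (x : ℝ) ^ B → ∀ w₁ w₂ : ℝ, 2 ≤ w₁ → w₁ ≤ x → 2 ≤ w₂ → w₂ ≤ x →
      ∑ n ∈ (Icc 1 x).filter (fun n : ℕ => (∀ p ∈ n.primeFactors, w₁ ≤ (p : ℝ)) ∧
          (∀ p ∈ (n + h).primeFactors, w₂ ≤ (p : ℝ) ∨ p ∣ h)),
        ((n.divisors.card : ℝ)) ^ a * (((n + h).divisors.card : ℝ)) ^ b ≤
      C * ((h : ℝ) / Nat.totient h) * (x : ℝ) / (Real.log w₁ * Real.log w₂) *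
        ((Real.log x / Real.log w₁) ^ κ * (Real.log x / Real.log w₂) ^ κ) := by
  obtain ⟨C₁, hC₁, κ₁, H₁⟩ := sum_pow_card_divisors_le a b B
  obtain ⟨C₂, hC₂, c, H₂⟩ := crude_shifted_sum_le a b B
  obtain ⟨κ, hκ⟩ : ∃ κ : ℕ, κ = κ₁ + c + 2 := ⟨_, rfl⟩
  obtain ⟨K₃, hK₃, hK₃b⟩ := log_pow_le_mul_sqrt' (κ + 1)
  obtain ⟨K₄, hK₄, hK₄b⟩ := log_pow_le_mul_sqrt' (c + 3)
  have hl2 : 0 < Real.log 2 := Real.log_pos one_lt_two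
  obtain ⟨Cnc, hCnc⟩ : ∃ C : ℝ, C = 2 ^ (a + b) * C₂ * ((B : ℝ) / Real.log 2 + 1) * (K₃ + K₄) :=
    ⟨_, rfl⟩
  obtain ⟨Csmall, hCsmall⟩ : ∃ C : ℝ, C = 36 * (4096 : ℝ) ^ (1 + a + b * (B + 2)) := ⟨_, rfl⟩
  have hCnc0 : 0 < Cnc := by rw [hCnc]; positivity
  have hCsmall0 : 0 < Csmall := by rw [hCsmall]; positivity
  refine ⟨C₁ + Cnc + Csmall, by positivity, κ, ?_⟩
  intro x h hx hh hhB w₁ w₂ hw₁ hw₁x hw₂ hw₂x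
  -- names and basic facts
  obtain ⟨F, hF⟩ : ∃ F : ℝ, F = (h : ℝ) / Nat.totient h := ⟨_, rfl⟩
  obtain ⟨L, hL⟩ : ∃ L : ℝ, L = Real.log w₁ * Real.log w₂ := ⟨_, rfl⟩
  obtain ⟨r₁, hr₁⟩ : ∃ r : ℝ, r = Real.log x / Real.log w₁ := ⟨_, rfl⟩
  obtain ⟨r₂, hr₂⟩ : ∃ r : ℝ, r = Real.log x / Real.log w₂ := ⟨_, rfl⟩
  have hh0 : h ≠ 0 := by omega
  have hx0 : (0 : ℝ) < x := by exact_mod_cast (show 0 < x by omega)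
  have hx2 : (2 : ℝ) ≤ x := by exact_mod_cast hx
  have hx1 : (1 : ℝ) ≤ x := by linarith
  have hlogx : 0 < Real.log x := Real.log_pos (by linarith)
  have hw₁0 : 0 < w₁ := by linarith
  have hlogw₁ : 0 < Real.log w₁ := Real.log_pos (by linarith)
  have hlogw₂ : 0 < Real.log w₂ := Real.log_pos (by linarith)
  have hlw₁x : Real.log w₁ ≤ Real.log x := Real.log_le_log (by linarith) hw₁x
  have hlw₂x : Real.log w₂ ≤ Real.log x := Real.log_le_log (by linarith) hw₂x
  have hL0 : 0 < L := by rw [hL]; exact mul_pos hlogw₁ hlogw₂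
  have hLx : L ≤ Real.log x ^ 2 := by rw [hL, sq]; exact mul_le_mul hlw₁x hlw₂x hlogw₂.le hlogx.le
  have hF1 : 1 ≤ F := by
    rw [hF, le_div_iff₀ (by exact_mod_cast Nat.totient_pos.mpr (by omega)), one_mul]
    exact_mod_cast Nat.totient_le h
  have hr₁1 : 1 ≤ r₁ := by rw [hr₁, le_div_iff₀ hlogw₁, one_mul]; exact hlw₁x
  have hr₂1 : 1 ≤ r₂ := by rw [hr₂, le_div_iff₀ hlogw₂, one_mul]; exact hlw₂x
  have hrr1 : 1 ≤ r₁ ^ κ * r₂ ^ κ := one_le_mul_of_one_le_of_one_le (one_le_pow₀ hr₁1) (one_le_pow₀ hr₂1)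
  obtain ⟨Φ, hΦ⟩ : ∃ Φ : ℝ, Φ = F * x / L * (r₁ ^ κ * r₂ ^ κ) := ⟨_, rfl⟩
  have hΦ0 : 0 < Φ := by rw [hΦ]; positivity
  have hxLΦ : (x : ℝ) / L * (r₁ ^ κ * r₂ ^ κ) ≤ Φ := by
    rw [hΦ]
    refine mul_le_mul_of_nonneg_right ?_ (by positivity)
    exact div_le_div_of_nonneg_right (le_mul_of_one_le_left hx0.le hF1) hL0.le
  have hΦx : (x : ℝ) / Real.log x ^ 2 ≤ Φ := by
    refine le_trans ?_ hxLΦ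
    calc (x : ℝ) / Real.log x ^ 2 ≤ (x : ℝ) / L := div_le_div_of_nonneg_left hx0.le hL0 hLx
      _ = x / L * 1 := (mul_one _).symm
      _ ≤ x / L * (r₁ ^ κ * r₂ ^ κ) := mul_le_mul_of_nonneg_left hrr1 (by positivity)
  have hfin : (C₁ + Cnc + Csmall) * F * x / L * (r₁ ^ κ * r₂ ^ κ) =
      C₁ * Φ + Cnc * Φ + Csmall * Φ := by
    rw [hΦ]; ring
  rw [← hF, ← hL, ← hr₁, ← hr₂, hfin]
  have h1Φ : 0 ≤ C₁ * Φ := by positivity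
  have h2Φ : 0 ≤ Cnc * Φ := by positivity
  have h3Φ : 0 ≤ Csmall * Φ := by positivity
  set A := (Icc 1 x).filter (fun n : ℕ => (∀ p ∈ n.primeFactors, w₁ ≤ (p : ℝ)) ∧
      (∀ p ∈ (n + h).primeFactors, w₂ ≤ (p : ℝ) ∨ p ∣ h)) with hA
  have hAsub : A ⊆ Icc 1 x := Finset.filter_subset _ _
  -- size of `n + h`
  have hN : ∀ n : ℕ, n ≤ x → ((n + h : ℕ) : ℝ) ≤ (x : ℝ) ^ (B + 2) := by
    intro n hn
    have hn' : (n : ℝ) ≤ x := by exact_mod_cast hn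
    have h1 : (x : ℝ) ≤ (x : ℝ) ^ (B + 1) := by
      calc (x : ℝ) = (x : ℝ) ^ 1 := (pow_one _).symm
        _ ≤ (x : ℝ) ^ (B + 1) := pow_le_pow_right₀ hx1 (by omega)
    have h2 : (x : ℝ) ^ B ≤ (x : ℝ) ^ (B + 1) := pow_le_pow_right₀ hx1 (by omega)
    have h3 : (x : ℝ) ^ (B + 2) = (x : ℝ) ^ (B + 1) * x := by ring
    push_cast
    nlinarith [pow_nonneg hx0.le (B + 1)]
  have hterm0 : ∀ n : ℕ, 0 ≤ ((n.divisors.card : ℝ)) ^ a * (((n + h).divisors.card : ℝ)) ^ b :=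
    fun n => by positivity
  ----------------------------------------------------------------
  -- small `x`
  ----------------------------------------------------------------
  by_cases hxs : x < 4096
  · have hxs' : (x : ℝ) < 4096 := by exact_mod_cast hxs
    have hterm : ∀ n ∈ A, ((n.divisors.card : ℝ)) ^ a * (((n + h).divisors.card : ℝ)) ^ b ≤
        (x : ℝ) ^ a * ((x : ℝ) ^ (B + 2)) ^ b := by
      intro n hn
      have hn' : n ∈ Icc 1 x := hAsub hn
      rw [Finset.mem_Icc] at hn'
      have h1 : ((n.divisors.card : ℝ)) ≤ x := by
        exact_mod_cast (Nat.card_divisors_le_self n).trans hn'.2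
      have h2 : (((n + h).divisors.card : ℝ)) ≤ (x : ℝ) ^ (B + 2) :=
        le_trans (by exact_mod_cast Nat.card_divisors_le_self (n + h)) (hN n hn'.2)
      exact mul_le_mul (pow_le_pow_left₀ (Nat.cast_nonneg _) h1 a)
        (pow_le_pow_left₀ (Nat.cast_nonneg _) h2 b) (by positivity) (by positivity)
    have hAcard : (#A : ℝ) ≤ x := by
      have h1 : #A ≤ #(Icc 1 x) := Finset.card_le_card hAsub
      rw [Nat.card_Icc, Nat.add_sub_cancel] at h1
      exact_mod_cast h1
    have hS : ∑ n ∈ A, ((n.divisors.card : ℝ)) ^ a * (((n + h).divisors.card : ℝ)) ^ b ≤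
        (4096 : ℝ) ^ (1 + a + b * (B + 2)) := by
      calc ∑ n ∈ A, ((n.divisors.card : ℝ)) ^ a * (((n + h).divisors.card : ℝ)) ^ b
          ≤ ∑ n ∈ A, (x : ℝ) ^ a * ((x : ℝ) ^ (B + 2)) ^ b := Finset.sum_le_sum hterm
        _ = #A * ((x : ℝ) ^ a * ((x : ℝ) ^ (B + 2)) ^ b) := by rw [Finset.sum_const, nsmul_eq_mul]
        _ ≤ x * ((x : ℝ) ^ a * ((x : ℝ) ^ (B + 2)) ^ b) :=
            mul_le_mul_of_nonneg_right hAcard (by positivity)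
        _ = (x : ℝ) ^ (1 + a + b * (B + 2)) := by ring
        _ ≤ (4096 : ℝ) ^ (1 + a + b * (B + 2)) := pow_le_pow_left₀ hx0.le hxs'.le _
    have hl2' : Real.log 2 < 0.6931471808 := Real.log_two_lt_d9
    have hlogx12 : Real.log x ≤ 12 * Real.log 2 := by
      have h1 := Real.log_le_log hx0 hxs'.le
      rw [show (4096 : ℝ) = 2 ^ 12 by norm_num, Real.log_pow] at h1
      push_cast at h1
      exact h1
    have hΦ36 : (1 : ℝ) / 36 ≤ Φ := by
      refine le_trans ?_ hΦx
      rw [div_le_div_iff₀ (by norm_num) (by positivity)]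
      have h1 : Real.log x ^ 2 ≤ (12 * Real.log 2) ^ 2 := pow_le_pow_left₀ hlogx.le hlogx12 2
      nlinarith [mul_pos hl2 (sub_pos.mpr hl2')]
    have hCs : (4096 : ℝ) ^ (1 + a + b * (B + 2)) ≤ Csmall * Φ := by
      rw [hCsmall]
      calc (4096 : ℝ) ^ (1 + a + b * (B + 2))
          = 36 * (4096 : ℝ) ^ (1 + a + b * (B + 2)) * (1 / 36) := by ring
        _ ≤ 36 * (4096 : ℝ) ^ (1 + a + b * (B + 2)) * Φ :=
            mul_le_mul_of_nonneg_left hΦ36 (by positivity)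
    linarith
  ----------------------------------------------------------------
  -- large `x`: split by coprimality with `h`
  ----------------------------------------------------------------
  push Not at hxs
  have hx8 : 8 ≤ x := by omega
  have hlogx1 : 1 ≤ Real.log x := by
    rw [Real.le_log_iff_exp_le hx0]
    have := Real.exp_one_lt_d9
    have : (4096 : ℝ) ≤ x := by exact_mod_cast hxs
    linarith
  rw [← Finset.sum_filter_add_sum_filter_not A (fun n : ℕ => Nat.Coprime n h)]
  -- (i) the `n` coprime to `h`
  have hcop : ∑ n ∈ A.filter (fun n : ℕ => Nat.Coprime n h),
      ((n.divisors.card : ℝ)) ^ a * (((n + h).divisors.card : ℝ)) ^ b ≤ C₁ * Φ := by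
    have H := H₁ x 1 h hx le_rfl hh (by rw [Nat.cast_one]; exact one_le_pow₀ hx1) hhB
      (Nat.coprime_one_left h) w₁ w₂ hw₁ hw₁x hw₂ hw₂x
    simp only [one_mul, Nat.totient_one, Nat.cast_one, div_one] at H
    rw [← hF, ← hL, ← hr₁, ← hr₂] at H
    have hsub : A.filter (fun n : ℕ => Nat.Coprime n h) ⊆
        (Icc 1 x).filter (fun n : ℕ => Nat.Coprime n h ∧ (∀ p ∈ n.primeFactors, w₁ ≤ (p : ℝ)) ∧
          (∀ p ∈ (n + h).primeFactors, w₂ ≤ (p : ℝ))) := by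
      intro n hn
      rw [Finset.mem_filter, hA, Finset.mem_filter] at hn
      obtain ⟨⟨hnI, hr1, hr2⟩, hcopr⟩ := hn
      refine Finset.mem_filter.mpr ⟨hnI, hcopr, hr1, fun p hp => ?_⟩
      rcases hr2 p hp with h1 | h1
      · exact h1
      · exfalso
        have hp' : p.Prime := Nat.prime_of_mem_primeFactors hp
        have hpn : p ∣ n + h := Nat.dvd_of_mem_primeFactors hp
        have hpn' : p ∣ n := by
          have := Nat.dvd_sub hpn h1
          rwa [Nat.add_sub_cancel] at this
        have hp1 : p ∣ Nat.gcd n h := Nat.dvd_gcd hpn' h1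
        rw [hcopr] at hp1
        exact hp'.one_lt.ne' (Nat.dvd_one.mp hp1)
    calc _ ≤ ∑ n ∈ (Icc 1 x).filter (fun n : ℕ => Nat.Coprime n h ∧
          (∀ p ∈ n.primeFactors, w₁ ≤ (p : ℝ)) ∧ (∀ p ∈ (n + h).primeFactors, w₂ ≤ (p : ℝ))),
          ((n.divisors.card : ℝ)) ^ a * (((n + h).divisors.card : ℝ)) ^ b :=
          Finset.sum_le_sum_of_subset_of_nonneg hsub fun n _ _ => hterm0 n
      _ ≤ C₁ * F * x / L * (r₁ ^ κ₁ * r₂ ^ κ₁) := H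
      _ ≤ C₁ * Φ := by
          rw [hΦ]
          have e1 : C₁ * F * x / L * (r₁ ^ κ₁ * r₂ ^ κ₁) = C₁ * (F * x / L) * (r₁ ^ κ₁ * r₂ ^ κ₁) := by
            ring
          have e2 : C₁ * (F * x / L * (r₁ ^ κ * r₂ ^ κ)) = C₁ * (F * x / L) * (r₁ ^ κ * r₂ ^ κ) := by ring
          rw [e1, e2]
          refine mul_le_mul_of_nonneg_left ?_ (by positivity)
          refine mul_le_mul (pow_le_pow_right₀ hr₁1 ?_) (pow_le_pow_right₀ hr₂1 ?_) (by positivity)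
            (by positivity)
          · rw [hκ]; omega
          · rw [hκ]; omega
  -- (ii) the `n` with `(n, h) > 1`
  have hnc : ∑ n ∈ A.filter (fun n : ℕ => ¬ Nat.Coprime n h),
      ((n.divisors.card : ℝ)) ^ a * (((n + h).divisors.card : ℝ)) ^ b ≤ Cnc * Φ := by
    set P := h.primeFactors.filter (fun p : ℕ => w₁ ≤ (p : ℝ)) with hP
    -- the primes available
    have hPcard : (#P : ℝ) ≤ (B : ℝ) * Real.log x / Real.log 2 := by
      have h1 : (#P : ℝ) ≤ #h.primeFactors := by exact_mod_cast Finset.card_filter_le _ _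
      -- `2^{ω(h)} ≤ h`, in logarithmic form (proved in several tree files, e.g. as
      -- `GreenTao2008.SharpGY.card_primeFactors_mul_log_two_le`; inlined to keep the imports light)
      have h2 : (h.primeFactors.card : ℝ) * Real.log 2 ≤ Real.log h := by
        have i1 : 2 ^ h.primeFactors.card ≤ ∏ p ∈ h.primeFactors, p :=
          Finset.pow_card_le_prod h.primeFactors (fun p => p) 2
            fun p hp => (Nat.prime_of_mem_primeFactors hp).two_le
        have i2 : ∏ p ∈ h.primeFactors, p ≤ h :=
          Nat.le_of_dvd (Nat.pos_of_ne_zero hh0) (Nat.prod_primeFactors_dvd h)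
        have i3 : ((2 : ℕ) : ℝ) ^ h.primeFactors.card ≤ (h : ℝ) := by exact_mod_cast i1.trans i2
        have i4 := Real.log_le_log (by positivity) i3
        rw [Real.log_pow] at i4
        push_cast at i4
        exact i4
      have h3 : Real.log h ≤ (B : ℝ) * Real.log x := by
        have := Real.log_le_log (by exact_mod_cast (show 0 < h by omega)) hhB
        rwa [Real.log_pow] at this
      rw [le_div_iff₀ hl2]
      nlinarith
    -- pointwise domination by the sum over `p ∈ P`, `p ∣ n`
    have hdom : ∀ n ∈ A.filter (fun n : ℕ => ¬ Nat.Coprime n h),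
        ((n.divisors.card : ℝ)) ^ a * (((n + h).divisors.card : ℝ)) ^ b ≤
          ∑ p ∈ P, if p ∣ n then ((n.divisors.card : ℝ)) ^ a * (((n + h).divisors.card : ℝ)) ^ b
            else 0 := by
      intro n hn
      rw [Finset.mem_filter, hA, Finset.mem_filter, Finset.mem_Icc] at hn
      obtain ⟨⟨⟨hn1, -⟩, hr1, -⟩, hncop⟩ := hn
      have hg1 : Nat.gcd n h ≠ 1 := hncop
      have hp : (Nat.gcd n h).minFac.Prime := Nat.minFac_prime hg1
      have hpg : (Nat.gcd n h).minFac ∣ Nat.gcd n h := Nat.minFac_dvd _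
      have hpn : (Nat.gcd n h).minFac ∣ n := hpg.trans (Nat.gcd_dvd_left n h)
      have hph : (Nat.gcd n h).minFac ∣ h := hpg.trans (Nat.gcd_dvd_right n h)
      have hpP : (Nat.gcd n h).minFac ∈ P := by
        rw [hP, Finset.mem_filter, Nat.mem_primeFactors]
        exact ⟨⟨hp, hph, hh0⟩, hr1 _ (Nat.mem_primeFactors.mpr ⟨hp, hpn, by omega⟩)⟩
      calc ((n.divisors.card : ℝ)) ^ a * (((n + h).divisors.card : ℝ)) ^ b
          = if (Nat.gcd n h).minFac ∣ n then
              ((n.divisors.card : ℝ)) ^ a * (((n + h).divisors.card : ℝ)) ^ b else 0 := by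
            rw [if_pos hpn]
        _ ≤ ∑ p ∈ P, if p ∣ n then ((n.divisors.card : ℝ)) ^ a * (((n + h).divisors.card : ℝ)) ^ b
              else 0 :=
            Finset.single_le_sum (f := fun p => if p ∣ n then
              ((n.divisors.card : ℝ)) ^ a * (((n + h).divisors.card : ℝ)) ^ b else 0)
              (fun q _ => by
                show (0 : ℝ) ≤ if q ∣ n then _ else 0
                split_ifs
                · exact hterm0 n
                · exact le_rfl) hpP
    -- the contribution of one prime `p ∈ P`
    have hinner : ∀ p ∈ P, ∑ n ∈ A.filter (fun n : ℕ => ¬ Nat.Coprime n h),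
        (if p ∣ n then ((n.divisors.card : ℝ)) ^ a * (((n + h).divisors.card : ℝ)) ^ b else 0) ≤
        2 ^ (a + b) * (C₂ * ((x : ℝ) / w₁ + Real.sqrt x) * Real.log x ^ c) := by
      intro p hp
      rw [hP, Finset.mem_filter, Nat.mem_primeFactors] at hp
      obtain ⟨⟨hpp, hph, -⟩, hpw⟩ := hp
      have hp0 : 0 < p := hpp.pos
      have hp0' : (0 : ℝ) < p := by exact_mod_cast hp0
      -- `h = p h'`, `1 ≤ h' ≤ x^B`
      have hh' : 1 ≤ h / p := Nat.div_pos (Nat.le_of_dvd (by omega) hph) hp0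
      have hh'B : ((h / p : ℕ) : ℝ) ≤ (x : ℝ) ^ B :=
        le_trans (by exact_mod_cast Nat.div_le_self h p) hhB
      have hphp : p * (h / p) = h := Nat.mul_div_cancel' hph
      -- step 1: restrict to the multiples of `p` in `[1, x]`
      have hs1 : ∑ n ∈ A.filter (fun n : ℕ => ¬ Nat.Coprime n h),
          (if p ∣ n then ((n.divisors.card : ℝ)) ^ a * (((n + h).divisors.card : ℝ)) ^ b else 0) ≤
          ∑ n ∈ (Icc 1 x).filter (fun n => p ∣ n),
            ((n.divisors.card : ℝ)) ^ a * (((n + h).divisors.card : ℝ)) ^ b := by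
        rw [← Finset.sum_filter]
        refine Finset.sum_le_sum_of_subset_of_nonneg ?_ fun n _ _ => hterm0 n
        intro n hn
        rw [Finset.mem_filter] at hn ⊢
        exact ⟨hAsub (Finset.mem_filter.mp hn.1).1, hn.2⟩
      -- step 2: reindex `n = pk` and use `τ(pk) ≤ 2τ(k)`, `pk + h = p(k + h')`
      have hs2 : ∑ n ∈ (Icc 1 x).filter (fun n => p ∣ n),
          ((n.divisors.card : ℝ)) ^ a * (((n + h).divisors.card : ℝ)) ^ b ≤
          2 ^ (a + b) * ∑ k ∈ Icc 1 (x / p),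
            ((k.divisors.card : ℝ)) ^ a * (((k + h / p).divisors.card : ℝ)) ^ b := by
        rw [sum_filter_dvd_eq hp0 x (fun n => ((n.divisors.card : ℝ)) ^ a *
          (((n + h).divisors.card : ℝ)) ^ b), Finset.mul_sum]
        refine Finset.sum_le_sum fun k _ => ?_
        have h1 : (((p * k).divisors.card : ℝ)) ≤ 2 * (k.divisors.card : ℝ) := by
          exact_mod_cast card_divisors_prime_mul_le hpp k
        have h2 : (((p * k + h).divisors.card : ℝ)) ≤ 2 * ((k + h / p).divisors.card : ℝ) := by
          have : p * k + h = p * (k + h / p) := by rw [mul_add, hphp]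
          rw [this]
          exact_mod_cast card_divisors_prime_mul_le hpp (k + h / p)
        calc (((p * k).divisors.card : ℝ)) ^ a * (((p * k + h).divisors.card : ℝ)) ^ b
            ≤ (2 * (k.divisors.card : ℝ)) ^ a * (2 * ((k + h / p).divisors.card : ℝ)) ^ b :=
              mul_le_mul (pow_le_pow_left₀ (Nat.cast_nonneg _) h1 a)
                (pow_le_pow_left₀ (Nat.cast_nonneg _) h2 b) (by positivity) (by positivity)
          _ = 2 ^ (a + b) * (((k.divisors.card : ℝ)) ^ a * (((k + h / p).divisors.card : ℝ)) ^ b) := by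
              rw [pow_add, mul_pow, mul_pow]; ring
      -- step 3: the crude bound and `x/p ≤ x/w₁`
      have hs3 := H₂ x (h / p) (x / p) hx8 hh' hh'B (Nat.div_le_self x p)
      have hs4 : (((x / p : ℕ) : ℝ)) ≤ (x : ℝ) / w₁ :=
        le_trans Nat.cast_div_le (div_le_div_of_nonneg_left hx0.le hw₁0 hpw)
      calc _ ≤ _ := hs1
        _ ≤ _ := hs2
        _ ≤ 2 ^ (a + b) * (C₂ * (((x / p : ℕ) : ℝ) + Real.sqrt x) * Real.log x ^ c) :=
            mul_le_mul_of_nonneg_left hs3 (by positivity)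
        _ ≤ 2 ^ (a + b) * (C₂ * ((x : ℝ) / w₁ + Real.sqrt x) * Real.log x ^ c) := by
            refine mul_le_mul_of_nonneg_left ?_ (by positivity)
            refine mul_le_mul_of_nonneg_right ?_ (by positivity)
            exact mul_le_mul_of_nonneg_left (by linarith) hC₂.le
    -- step 4: the two absorptions
    have habs1 : (x : ℝ) * Real.log x ^ (c + 1) / w₁ ≤ K₃ * ((x : ℝ) / L * (r₁ ^ κ * r₂ ^ κ)) := by
      have hlw₁1 : (1 : ℝ) ≤ w₁ := by linarith
      have hK3' : Real.log w₁ ^ (κ + 1) ≤ K₃ * w₁ := by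
        refine (hK₃b w₁ hlw₁1).trans (mul_le_mul_of_nonneg_left ?_ hK₃.le)
        rw [Real.sqrt_le_left (by linarith)]
        nlinarith
      have hmid : Real.log x ^ (c + 1) * Real.log w₂ ^ (κ + 1) ≤ Real.log x ^ κ * Real.log x ^ κ := by
        calc Real.log x ^ (c + 1) * Real.log w₂ ^ (κ + 1)
            ≤ Real.log x ^ (c + 1) * Real.log x ^ (κ + 1) :=
              mul_le_mul_of_nonneg_left (pow_le_pow_left₀ hlogw₂.le hlw₂x _) (by positivity)
          _ = Real.log x ^ (c + 1 + (κ + 1)) := (pow_add _ _ _).symm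
          _ ≤ Real.log x ^ (κ + κ) := pow_le_pow_right₀ hlogx1 (by rw [hκ]; omega)
          _ = Real.log x ^ κ * Real.log x ^ κ := pow_add _ _ _
      have eR : (x : ℝ) / L * (r₁ ^ κ * r₂ ^ κ) =
          x * (Real.log x ^ κ * Real.log x ^ κ) / (Real.log w₁ ^ (κ + 1) * Real.log w₂ ^ (κ + 1)) := by
        rw [hL, hr₁, hr₂, div_pow, div_pow]
        field_simp
        ring
      rw [eR, mul_div_assoc', div_le_div_iff₀ hw₁0 (by positivity)]
      calc (x : ℝ) * Real.log x ^ (c + 1) * (Real.log w₁ ^ (κ + 1) * Real.log w₂ ^ (κ + 1))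
          = x * (Real.log x ^ (c + 1) * Real.log w₂ ^ (κ + 1)) * Real.log w₁ ^ (κ + 1) := by ring
        _ ≤ x * (Real.log x ^ κ * Real.log x ^ κ) * (K₃ * w₁) :=
            mul_le_mul (mul_le_mul_of_nonneg_left hmid hx0.le) hK3' (by positivity) (by positivity)
        _ = K₃ * (x * (Real.log x ^ κ * Real.log x ^ κ)) * w₁ := by ring
    have habs2 : Real.sqrt x * Real.log x ^ (c + 1) ≤ K₄ * ((x : ℝ) / Real.log x ^ 2) := by
      have hc' := hK₄b x hx1
      rw [mul_div_assoc', le_div_iff₀ (by positivity)]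
      calc Real.sqrt x * Real.log x ^ (c + 1) * Real.log x ^ 2
          = Real.sqrt x * Real.log x ^ (c + 3) := by ring
        _ ≤ Real.sqrt x * (K₄ * Real.sqrt x) := mul_le_mul_of_nonneg_left hc' (Real.sqrt_nonneg _)
        _ = K₄ * x := by rw [mul_left_comm, Real.mul_self_sqrt hx0.le]
    have habs : Real.log x * (((x : ℝ) / w₁ + Real.sqrt x) * Real.log x ^ c) ≤ (K₃ + K₄) * Φ := by
      have e : Real.log x * (((x : ℝ) / w₁ + Real.sqrt x) * Real.log x ^ c) =
          (x : ℝ) * Real.log x ^ (c + 1) / w₁ + Real.sqrt x * Real.log x ^ (c + 1) := by ring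
      rw [e, add_mul]
      refine add_le_add (habs1.trans (mul_le_mul_of_nonneg_left hxLΦ hK₃.le))
        (habs2.trans (mul_le_mul_of_nonneg_left hΦx hK₄.le))
    -- assemble (ii)
    calc ∑ n ∈ A.filter (fun n : ℕ => ¬ Nat.Coprime n h),
          ((n.divisors.card : ℝ)) ^ a * (((n + h).divisors.card : ℝ)) ^ b
        ≤ ∑ n ∈ A.filter (fun n : ℕ => ¬ Nat.Coprime n h), ∑ p ∈ P,
            (if p ∣ n then ((n.divisors.card : ℝ)) ^ a * (((n + h).divisors.card : ℝ)) ^ b else 0) :=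
          Finset.sum_le_sum hdom
      _ = ∑ p ∈ P, ∑ n ∈ A.filter (fun n : ℕ => ¬ Nat.Coprime n h),
            (if p ∣ n then ((n.divisors.card : ℝ)) ^ a * (((n + h).divisors.card : ℝ)) ^ b else 0) :=
          Finset.sum_comm
      _ ≤ ∑ p ∈ P, 2 ^ (a + b) * (C₂ * ((x : ℝ) / w₁ + Real.sqrt x) * Real.log x ^ c) :=
          Finset.sum_le_sum hinner
      _ = #P * (2 ^ (a + b) * (C₂ * ((x : ℝ) / w₁ + Real.sqrt x) * Real.log x ^ c)) := by
          rw [Finset.sum_const, nsmul_eq_mul]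
      _ ≤ ((B : ℝ) * Real.log x / Real.log 2) *
            (2 ^ (a + b) * (C₂ * ((x : ℝ) / w₁ + Real.sqrt x) * Real.log x ^ c)) :=
          mul_le_mul_of_nonneg_right hPcard (by positivity)
      _ = 2 ^ (a + b) * C₂ * ((B : ℝ) / Real.log 2) *
            (Real.log x * (((x : ℝ) / w₁ + Real.sqrt x) * Real.log x ^ c)) := by
          field_simp
      _ ≤ 2 ^ (a + b) * C₂ * ((B : ℝ) / Real.log 2) * ((K₃ + K₄) * Φ) :=
          mul_le_mul_of_nonneg_left habs (by positivity)
      _ ≤ 2 ^ (a + b) * C₂ * ((B : ℝ) / Real.log 2 + 1) * ((K₃ + K₄) * Φ) := by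
          refine mul_le_mul_of_nonneg_right ?_ (by positivity)
          refine mul_le_mul_of_nonneg_left (by linarith) (by positivity)
      _ = Cnc * Φ := by rw [hCnc]; ring
  linarith

end PairDivisorSums

end Literature.NumberTheory.Sieve
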